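/-
Origin: expansion seat `planner-pub-hodgecm-pv09-g4-0`, handover #18 2026-08-18T08:25:01Z (`HOME/pub-hodgecm-pv09-g4/lean/Pv09g4/LocSecondCountable.lean`, md5 0ca5d2a6, 77 lines);
landed by the gen-7 packager in gate run 27 as `HodgeCM/PerL34/LocSecondCountable.lean` (import ^import Pv[0-9]+g[0-9]+\.→import HodgeCM.PerL34. ×1).
-/
/-
HodgeCM / PerL34 publication cell — seam S3 set-up, model side (pub-hodgecm-pv09-g4, HANDOVER #18).
WIP import: `Pv09g4.LocTorusClosed` ↦ `HodgeCM.PerL34.LocTorusClosed`; the vendored file is tree.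
Complete proofs, no new axioms, nothing cited.
-/
import Summits.HodgeConjecture.HodgeCM.PerL34.LocTorusClosed
import Literature.NumberTheory.Automorphic.AdicCompletionCompact
import Mathlib.NumberTheory.NumberField.Completion.InfinitePlace

/-!
# Second countability and Borel structure of the local groups `locTorus K L v`

Per-place item (d3) of GAPS pv09g4-A6: the END's per-index instance binders `[SecondCountableTopology (G v)]`,
`[MeasurableSpace (G v)] [BorelSpace (G v)]` for the genuine local groups `G v := locTorus K L v`.
Sources (all kernel): `K_v` proper (vendored `properSpace_adicCompletion`, from compactness of `𝒪_v`) ⇒ second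
countable; `L_w ↪ ℂ` isometric (Mathlib `isometry_extensionEmbedding`) ⇒ second countable; units of a second
countable monoid are second countable (`Units.isEmbedding_embedProduct`); finite products and subgroups.
The Borel σ-algebra is then put on `locTorus K L v` by definition.
-/

set_option autoImplicit false

noncomputable section

open Topology TopologicalSpace NumberField IsDedekindDomain
open scoped RestrictedProduct

namespace HodgeCM.PerL34.IdelicTorusModel

open IdelePlaces RestrictedRegroup RestrictedCutout

/-- Units of a second-countable topological monoid are second countable. -/
theorem secondCountableTopology_units (M : Type*) [Monoid M] [TopologicalSpace M] [SecondCountableTopology M] :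
    SecondCountableTopology Mˣ := by
  haveI : SecondCountableTopology Mᵐᵒᵖ := MulOpposite.opHomeomorph.symm.isEmbedding.secondCountableTopology
  exact Units.isEmbedding_embedProduct.secondCountableTopology

variable (L : Type) [Field L] [NumberField L]

/-- `L_v` (finite place) is second countable: it is a proper metric space. -/
theorem secondCountableTopology_adicCompletion (v : HeightOneSpectrum (𝓞 L)) :
    SecondCountableTopology (v.adicCompletion L) := by
  haveI : ProperSpace (v.adicCompletion L) := Literature.NumberTheory.Automorphic.properSpace_adicCompletion L v
  infer_instance

omit [NumberField L] in
/-- `L_w` (infinite place) is second countable: it embeds isometrically into `ℂ`. -/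
theorem secondCountableTopology_infiniteCompletion (w : InfinitePlace L) :
    SecondCountableTopology w.Completion :=
  (InfinitePlace.Completion.isometry_extensionEmbedding w).isEmbedding.secondCountableTopology

/-- `L_wˣ` is second countable (both kinds of places). -/
instance instSecondCountableTopologyLocUnits : ∀ i : Place L, SecondCountableTopology (LocUnits L i)
  | .inl w => by
    haveI := secondCountableTopology_infiniteCompletion L w
    exact secondCountableTopology_units w.Completion
  | .inr v => by
    haveI := secondCountableTopology_adicCompletion L v
    exact secondCountableTopology_units (v.adicCompletion L)

variable (K : Type) [Field K] [NumberField K] [Algebra K L] [FiniteDimensional K L]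

example (k : Place K) : SecondCountableTopology (FibGroup K L k) := inferInstance

/-- **`locTorus K L v` is second countable.** -/
instance secondCountableTopology_locTorus (k : Place K) : SecondCountableTopology (locTorus K L k) :=
  (Topology.IsEmbedding.subtypeVal :
    Topology.IsEmbedding ((↑) : locTorus K L k → FibGroup K L k)).secondCountableTopology

/-- The Borel σ-algebra on `locTorus K L v` (by definition). -/
instance measurableSpace_locTorus (k : Place K) : MeasurableSpace (locTorus K L k) := borel _

/-- (Ported verbatim from the HodgeCMPerL package; no docstring in the source.) -/
instance borelSpace_locTorus (k : Place K) : BorelSpace (locTorus K L k) := ⟨rfl⟩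

end HodgeCM.PerL34.IdelicTorusModel

end
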